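import Summits.QuantumFields.BalabanUV.T4Continuum.Support.NE3CovariantBlockTrace
import Summits.QuantumFields.BalabanUV.T4Continuum.Support.NE3CovariantSBound
import HarnessLib

/-!
# T⁴ programme, node NE3 — route H♮, row K6-face: THE FOUR FACE PAIRINGS OF THE K6 ASSEMBLY IN CLOSED FORM —
# `|Σ_z hsR (ψ z) (Σ_κ farDefect)|`, `|Σ_z hsR (ψ z) (Σ_κ nearDefect)|`, `|Σ_z hsR (ψ z) (coarseMismatch U W M η z)|` and the face-jump
# pairing `|Σ_xΣ_κ hsR (JmpW M W E x κ) (η x κ)|`, each `≤ (its first-order letter) · √(coarse ℓ²) · √(M^{d−1}·(2M⁻¹·Σ‖η‖²_HS + 2M·Σ‖covFd W η · κ κ‖²_HS))`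

NE3 formalisation swarm `b2b-balaban-t4-ne3-formalise-*`, LEAF PROVER 03 (unit `b2b-balaban-t4-ne3-formalise-leaf-03`, gen 8; cell
`pub-balaban`); row **K6-face** = the NE3 row owner's OFFER in the K6-tr race resolution (journal l.19231) — «the three FACE PAIRINGS of
blueprint `D-ne3p1-g23-1.md` §2(b)(c) + K4-d2's face-jump pairing as closed-form kernel inequalities with every constant explicit, so K6
only adds them up»; INTENT ∕ CLAIM journal l.19382 («K6-face MINE»).

INPUTS BY NAME.  K4-c file 1 `NE3CovariantBlockDivergence` (owner g23): `farDefect`, `nearDefect` and their FIRST-ORDER op-norm bounds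
`norm_farDefect_le` ∕ `norm_nearDefect_le` (`≤ 2(d−1)(M−1)M·a · Σ_t ‖η(face bond)‖`); K4-c file 2 `NE3CovariantLandauKill`: `coarseMismatch`,
`norm_coarseMismatch_le` (`≤ Σ_κ 2‖U(z−e_κ,κ) − bseg M W (z−e_κ) κ‖ · Σ_t ‖η(far face of B(z−e_κ))‖`); K4-d2 `NE3CovariantSBound`:
`abs_sum_hsR_JmpW_le` (`≤ M²·Σ_zΣ_κ nhsNorm (E z κ)·Σ_t nhsNorm (η(far face))`), `abs_hsR_le_nhsNorm`; K6-tr `NE3CovariantBlockTrace`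
(owner g23): THE DISCRETE COVARIANT TRACE INEQUALITY `sum_nhsNormSq_farFace_le` (`Σ_t nhsNormSq (η (M•z+t+(M−1)e_κ) κ) ≤ 2∕M·Σ_B nhsNormSq η_κ
+ 2M·Σ_B nhsNormSq (covFd W η · κ κ)`); `MatrixNorms.nhsNorm_le_opNorm` ∕ `opNorm_le_sqrt_card_mul_nhsNorm` (the one `√(card n)`: the defect
bounds of K4-c are operator-norm bounds on `η`, the pairing is Hilbert–Schmidt).

CONTENT (all [folklore]; 0 sorry; 0 `def`).  `M ≥ 1`; `W` unitary with `SmallField W a`, `0 ≤ a` (P1, P2); ANY coarse `ψ : Site d → Matrix n n ℂ`;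
`η` `(M·N)`-periodic for the near-face∕mismatch pairings (P2, P3 — the near face of `B(z)` is the far face of `B(z − e_κ)`, shifted back on the
coarse torus); letters `E_η := Σ_{x∈periodBox (M·N)}Σ_κ nhsNormSq (η x κ)`, `DG := Σ_xΣ_κ nhsNormSq (covFd W η x κ κ)` (the DIAGONAL covariant
gradient, `≤` K4-d1's `CG`), `Ψ := Σ_{z∈periodBox N} nhsNormSq (ψ z)`, `FE := M^{d−1}·(2∕M·E_η + 2M·DG)`:
§1 helpers: `abs_hsR_le_nhsNorm_mul_opNorm`, `sum_opNorm_le_sqrt_card_mul` (Cauchy–Schwarz with square roots is inlined in §3's two pairing steps);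
§2 THE FACE ENERGY ON THE TORUS **`sum_sq_farFaceL1_le`**: `Σ_{z∈periodBox N}Σ_κ (Σ_t nhsNorm (η (M•z+t+(M−1)e_κ) κ))² ≤ FE` (K6-tr + Cauchy–Schwarz
   over the `M^{d−1}` face sites + block tiling) and its shifted twin **`sum_sq_nearFaceL1_le`** (`η` `(M·N)`-periodic, `N ≥ 1`): the same for the
   near faces `M•z+t−e_κ`;
§3 **(P1) `abs_sum_hsR_farDefect_le`**: `|Σ_{z∈periodBox N} hsR (ψ z) (Σ_κ farDefect W M η z κ)| ≤ 2(d−1)(M−1)M·a·√(card n)·√(d·Ψ)·√FE`;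
   **(P2) `abs_sum_hsR_nearDefect_le`**: the same bound for `nearDefect`;
   **(P3) `abs_sum_hsR_coarseMismatch_le`** (ANY unitary coarse `U` with a displayed bond-closeness letter `‖U z κ − bseg M W z κ‖ ≤ β`, which K6
   instantiates by NE3-R2 g8's J4 `NE3TowerBondVsSegment.norm_cavgIter_sub_bseg_le`; no smallness of `W` needed):
   `|Σ_z hsR (ψ z) (coarseMismatch U W M η z)| ≤ 2β·√(card n)·√(d·Ψ)·√FE`;
   **(P4) `abs_sum_hsR_JmpW_le_sqrt`** (ANY coarse `E`): `|Σ_{x∈periodBox (M·N)}Σ_κ hsR (JmpW M W E x κ) (η x κ)| ≤ M²·√(Σ_zΣ_κ nhsNormSq (E z κ))·√FE`.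
Every pairing thus carries its first-order letter (`(d−1)(M−1)M·a ≤ d·θ`, `β = J4`, or the ℓ² size of the non-exact part `E`) against
`√(coarse ℓ²)·√(M^{d−2}·E_η + M^d·DG)` — no bare `M^{1∕2}` (blueprint §2(b): «WITH it every face pairing is absorbable by `2ab ≤ a² + b²`»).

HONEST FRAMING.  Cauchy–Schwarz bookkeeping over the quoted first-order bounds of K4-c∕K4-d2 and the owner's K6-tr, on OUR typed objects at
ONE configuration; no estimate of NE3's beyond them; nothing about Bałaban's minimisers; (P♮)_W, (ML_w) at W ≠ 1, T-E_w and NE3 are NOT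
proved; spine PROVED 0∕9; finite T⁴ rung (B)+1 — NOT infinite volume, NOT mass gap, NOT BetaPertH, NOT Clay.  ABSOLUTE RULE kept (nothing
printed is a hypothesis; context only: [Balaban1985Averaging] (42) p. 23, pp. 24–25).  PLACEMENT: `Summits/QuantumFields/BalabanUV/`; imports the
accepted `NE3CovariantBlockTrace` p231121 and `NE3CovariantSBound` p230604 only.  HONEST DEPENDENCY (cell page 1): continuum YM on T⁴ ⇐ BetaPertH ∧
nine spine estimates (0/9 proved); BetaPertH ⇐ (D1) ∧ (D4) ∧ CAP+tail; G-an2-4 gates asym, D1 and NE2/3/4.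
-/

set_option autoImplicit false

open scoped BigOperators Matrix.Norms.L2Operator
open Finset

namespace Summit.QuantumFields.BalabanUV.T4Continuum.NE3CovariantFacePairings

open Literature.MathematicalPhysics.QuantumFieldTheory.Balaban1983to89
open B7Prop1Explicit B7Prop2Explicit MatrixNorms
open T4AveragingDeficitWall (IsUnitaryCfg SmallField Ad)
open T4AveragingDeficitWallBoundary (periodBox mem_periodBox card_periodBox sum_periodBox_shift)
open AveragingDeficitCovGrad (covFd)
open AveragingDeficitBlockDensity (bseg)
open NE3StraightAverageAdjoint (tbase)
open NE3CovariantCalculus (hsR hsR_sum_right)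
open NE3CovariantLineAdjoint (JmpW)
open NE3CovariantBlockDivergence (farDefect nearDefect norm_farDefect_le norm_nearDefect_le)
open NE3CovariantLandauKill (coarseMismatch norm_coarseMismatch_le)
open NE3CovariantSBound (abs_hsR_le_nhsNorm abs_sum_hsR_JmpW_le)
open NE3CovariantBlockTrace (sum_nhsNormSq_farFace_le)
open NE3BlockPoincareCore (sum_blocks_torus)

noncomputable section

variable {d : ℕ} {n : Type*} [Fintype n] [DecidableEq n]

/-! ## §1 Helpers -/

/-- `|hsR X Y| ≤ nhsNorm X · ‖Y‖` (HS pairing against an operator-norm bound). [folklore] -/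
theorem abs_hsR_le_nhsNorm_mul_opNorm (X Y : Matrix n n ℂ) : |hsR X Y| ≤ nhsNorm X * ‖Y‖ :=
  (abs_hsR_le_nhsNorm X Y).trans (mul_le_mul_of_nonneg_left (nhsNorm_le_opNorm Y) (nhsNorm_nonneg X))

/-- `Σ ‖f i‖ ≤ √(card n)·Σ nhsNorm (f i)` (the operator norm against the normalised Hilbert–Schmidt norm, termwise). [folklore] -/
theorem sum_opNorm_le_sqrt_card_mul {ι : Type*} (s : Finset ι) (f : ι → Matrix n n ℂ) :
    ∑ i ∈ s, ‖f i‖ ≤ Real.sqrt (Fintype.card n) * ∑ i ∈ s, nhsNorm (f i) := by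
  rw [mul_sum]
  exact sum_le_sum fun i _ => opNorm_le_sqrt_card_mul_nhsNorm (f i)

/-! ## §2 The face energy on the torus -/

section Faces

variable [Nonempty n]

/-- **THE FAR-FACE ENERGY ON THE TORUS** (unitary `W`, `M ≥ 1`, any `N`, any `η`):
`Σ_{z∈periodBox N}Σ_κ (Σ_t nhsNorm (η (M•z+t+(M−1)e_κ) κ))² ≤ M^{d−1}·(2∕M·Σ_{x∈periodBox (M·N)}Σ_κ nhsNormSq (η x κ) + 2M·Σ_xΣ_κ nhsNormSq (covFd W η x κ κ))`
(the owner's K6-tr per block and component, Cauchy–Schwarz over the `M^{d−1}` face sites, block tiling). [folklore] -/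
theorem sum_sq_farFaceL1_le {M : ℕ} (hM : 1 ≤ M) (N : ℕ) {W : Site d → Fin d → (Matrix n n ℂ)ˣ} (hW : IsUnitaryCfg W)
    (η : Site d → Fin d → Matrix n n ℂ) :
    ∑ z ∈ periodBox (d := d) N, ∑ κ : Fin d,
        (∑ r' : {j : Fin d // j ≠ κ} → Fin M, nhsNorm (η ((M : ℤ) • z + tbase κ r' + ((M : ℤ) - 1) • e κ) κ)) ^ 2
      ≤ (M : ℝ) ^ (d - 1) * (2 / (M : ℝ) * ∑ x ∈ periodBox (d := d) (M * N), ∑ κ : Fin d, nhsNormSq (η x κ)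
          + 2 * (M : ℝ) * ∑ x ∈ periodBox (d := d) (M * N), ∑ κ : Fin d, nhsNormSq (covFd W η x κ κ)) := by
  have hcard : ∀ κ : Fin d, (Fintype.card ({j : Fin d // j ≠ κ} → Fin M) : ℝ) = (M : ℝ) ^ (d - 1) := by
    intro κ
    rw [Fintype.card_fun, Fintype.card_fin, Fintype.card_subtype_compl, Fintype.card_fin, Fintype.card_unique]
    push_cast; ring
  have hblock : ∀ (z : Site d) (κ : Fin d),
      (∑ r' : {j : Fin d // j ≠ κ} → Fin M, nhsNorm (η ((M : ℤ) • z + tbase κ r' + ((M : ℤ) - 1) • e κ) κ)) ^ 2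
        ≤ (M : ℝ) ^ (d - 1) * (2 / (M : ℝ) * ∑ v ∈ periodBox (d := d) M, nhsNormSq (η ((M : ℤ) • z + v) κ)
            + 2 * (M : ℝ) * ∑ v ∈ periodBox (d := d) M, nhsNormSq (covFd W η ((M : ℤ) • z + v) κ κ)) := by
    intro z κ
    have hcs := sq_sum_le_card_mul_sum_sq (s := (univ : Finset ({j : Fin d // j ≠ κ} → Fin M)))
      (f := fun r' => nhsNorm (η ((M : ℤ) • z + tbase κ r' + ((M : ℤ) - 1) • e κ) κ))
    rw [card_univ] at hcs
    simp only [nhsNorm_sq] at hcs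
    have h1 : ((∑ r' : {j : Fin d // j ≠ κ} → Fin M, nhsNorm (η ((M : ℤ) • z + tbase κ r' + ((M : ℤ) - 1) • e κ) κ)) ^ 2 : ℝ)
        ≤ (Fintype.card ({j : Fin d // j ≠ κ} → Fin M) : ℝ)
            * ∑ r' : {j : Fin d // j ≠ κ} → Fin M, nhsNormSq (η ((M : ℤ) • z + tbase κ r' + ((M : ℤ) - 1) • e κ) κ) := by
      exact_mod_cast hcs
    rw [hcard κ] at h1
    exact h1.trans (mul_le_mul_of_nonneg_left (sum_nhsNormSq_farFace_le hM hW η z κ) (by positivity))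
  have hsum := sum_le_sum fun z (_ : z ∈ periodBox (d := d) N) =>
    sum_le_sum fun κ (_ : κ ∈ (univ : Finset (Fin d))) => hblock z κ
  refine hsum.trans (le_of_eq ?_)
  have hE : ∑ z ∈ periodBox (d := d) N, ∑ κ : Fin d, ∑ v ∈ periodBox (d := d) M, nhsNormSq (η ((M : ℤ) • z + v) κ)
      = ∑ x ∈ periodBox (d := d) (M * N), ∑ κ : Fin d, nhsNormSq (η x κ) := by
    rw [← sum_blocks_torus hM N (fun x => ∑ κ : Fin d, nhsNormSq (η x κ))]
    exact sum_congr rfl fun z _ => sum_comm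
  have hD : ∑ z ∈ periodBox (d := d) N, ∑ κ : Fin d, ∑ v ∈ periodBox (d := d) M, nhsNormSq (covFd W η ((M : ℤ) • z + v) κ κ)
      = ∑ x ∈ periodBox (d := d) (M * N), ∑ κ : Fin d, nhsNormSq (covFd W η x κ κ) := by
    rw [← sum_blocks_torus hM N (fun x => ∑ κ : Fin d, nhsNormSq (covFd W η x κ κ))]
    exact sum_congr rfl fun z _ => sum_comm
  simp only [mul_add, sum_add_distrib, ← mul_sum]
  rw [hE, hD]

omit [DecidableEq n] [Nonempty n] in
/-- The far-face `ℓ¹` sum of an `(M·N)`-periodic field is `N`-periodic in the block index. [folklore] -/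
theorem farFaceL1_add_period {M N : ℕ} (η : Site d → Fin d → Matrix n n ℂ)
    (hη : ∀ (x : Site d) (τ μ : Fin d), η (x + ((M * N : ℕ) : ℤ) • e τ) μ = η x μ) (κ : Fin d) (z : Site d) (τ : Fin d) :
    ∑ r' : {j : Fin d // j ≠ κ} → Fin M, nhsNorm (η ((M : ℤ) • (z + (N : ℤ) • e τ) + tbase κ r' + ((M : ℤ) - 1) • e κ) κ)
      = ∑ r' : {j : Fin d // j ≠ κ} → Fin M, nhsNorm (η ((M : ℤ) • z + tbase κ r' + ((M : ℤ) - 1) • e κ) κ) := by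
  refine sum_congr rfl fun r' _ => ?_
  have : (M : ℤ) • (z + (N : ℤ) • e τ) + tbase κ r' + ((M : ℤ) - 1) • e κ
      = (M : ℤ) • z + tbase κ r' + ((M : ℤ) - 1) • e κ + ((M * N : ℕ) : ℤ) • e τ := by
    rw [smul_add, smul_smul]; push_cast; abel
  rw [this, hη]

omit [Nonempty n] in
/-- The near face of `B(z)` is the far face of `B(z − e_κ)`: `M•z + t − e_κ = M•(z + (−e_κ)) + t + (M−1)•e_κ`. [folklore] -/
theorem nearFace_site_eq (M : ℕ) (κ : Fin d) (z t : Site d) :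
    (M : ℤ) • z + t - e κ = (M : ℤ) • (z + -e κ) + t + ((M : ℤ) - 1) • e κ := by
  rw [smul_add, smul_neg, sub_smul, one_smul]; abel

/-- **THE SHIFTED FAR-FACE ENERGY** (`η` `(M·N)`-periodic, `N ≥ 1`): summing the far-face energy of the blocks `z − e_κ` over the coarse
torus gives the same bound — `Σ_{z∈periodBox N}Σ_κ (Σ_t nhsNorm (η (M•(z−e_κ)+t+(M−1)e_κ) κ))² ≤ M^{d−1}·(2∕M·E_η + 2M·DG)`. [folklore] -/
theorem sum_sq_farFaceL1_shift_le {M N : ℕ} (hM : 1 ≤ M) (hN : 1 ≤ N) {W : Site d → Fin d → (Matrix n n ℂ)ˣ} (hW : IsUnitaryCfg W)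
    (η : Site d → Fin d → Matrix n n ℂ) (hη : ∀ (x : Site d) (τ μ : Fin d), η (x + ((M * N : ℕ) : ℤ) • e τ) μ = η x μ) :
    ∑ z ∈ periodBox (d := d) N, ∑ κ : Fin d,
        (∑ r' : {j : Fin d // j ≠ κ} → Fin M, nhsNorm (η ((M : ℤ) • (z + -e κ) + tbase κ r' + ((M : ℤ) - 1) • e κ) κ)) ^ 2
      ≤ (M : ℝ) ^ (d - 1) * (2 / (M : ℝ) * ∑ x ∈ periodBox (d := d) (M * N), ∑ κ : Fin d, nhsNormSq (η x κ)
          + 2 * (M : ℝ) * ∑ x ∈ periodBox (d := d) (M * N), ∑ κ : Fin d, nhsNormSq (covFd W η x κ κ)) := by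
  set F : Fin d → Site d → ℝ := fun κ z =>
    (∑ r' : {j : Fin d // j ≠ κ} → Fin M, nhsNorm (η ((M : ℤ) • z + tbase κ r' + ((M : ℤ) - 1) • e κ) κ)) ^ 2 with hF
  have hFper : ∀ (κ : Fin d) (z : Site d) (τ : Fin d), F κ (z + (N : ℤ) • e τ) = F κ z := by
    intro κ z τ; simp only [hF, farFaceL1_add_period η hη]
  calc ∑ z ∈ periodBox (d := d) N, ∑ κ : Fin d,
        (∑ r' : {j : Fin d // j ≠ κ} → Fin M, nhsNorm (η ((M : ℤ) • (z + -e κ) + tbase κ r' + ((M : ℤ) - 1) • e κ) κ)) ^ 2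
      = ∑ κ : Fin d, ∑ z ∈ periodBox (d := d) N, F κ (z + -e κ) := by rw [sum_comm]
    _ = ∑ κ : Fin d, ∑ z ∈ periodBox (d := d) N, F κ z :=
        sum_congr rfl fun κ _ => sum_periodBox_shift N hN (hFper κ) (-e κ)
    _ = ∑ z ∈ periodBox (d := d) N, ∑ κ : Fin d, F κ z := sum_comm
    _ ≤ _ := by simpa only [hF] using sum_sq_farFaceL1_le hM N hW η

/-- **THE NEAR-FACE ENERGY ON THE TORUS** (unitary `W`, `M, N ≥ 1`, `η` `(M·N)`-periodic):
`Σ_{z∈periodBox N}Σ_κ (Σ_t nhsNorm (η (M•z+t−e_κ) κ))² ≤ M^{d−1}·(2∕M·Σ_xΣ_κ nhsNormSq (η x κ) + 2M·Σ_xΣ_κ nhsNormSq (covFd W η x κ κ))`. [folklore] -/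
theorem sum_sq_nearFaceL1_le {M N : ℕ} (hM : 1 ≤ M) (hN : 1 ≤ N) {W : Site d → Fin d → (Matrix n n ℂ)ˣ} (hW : IsUnitaryCfg W)
    (η : Site d → Fin d → Matrix n n ℂ) (hη : ∀ (x : Site d) (τ μ : Fin d), η (x + ((M * N : ℕ) : ℤ) • e τ) μ = η x μ) :
    ∑ z ∈ periodBox (d := d) N, ∑ κ : Fin d,
        (∑ r' : {j : Fin d // j ≠ κ} → Fin M, nhsNorm (η ((M : ℤ) • z + tbase κ r' - e κ) κ)) ^ 2
      ≤ (M : ℝ) ^ (d - 1) * (2 / (M : ℝ) * ∑ x ∈ periodBox (d := d) (M * N), ∑ κ : Fin d, nhsNormSq (η x κ)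
          + 2 * (M : ℝ) * ∑ x ∈ periodBox (d := d) (M * N), ∑ κ : Fin d, nhsNormSq (covFd W η x κ κ)) := by
  simp only [nearFace_site_eq]
  exact sum_sq_farFaceL1_shift_le hM hN hW η hη

end Faces

/-! ## §3 The four face pairings -/

section Pairings

variable [Nonempty n] {M N : ℕ} {W : Site d → Fin d → (Matrix n n ℂ)ˣ} {a : ℝ}

omit [DecidableEq n] [Nonempty n] in
/-- The generic pairing step: a coarse scalar weight against face sums, Cauchy–Schwarz over `(z, κ)`:
`Σ_zΣ_κ nhsNorm (ψ z)·F z κ ≤ √(d·Σ_z nhsNormSq (ψ z))·√(Σ_zΣ_κ (F z κ)²)`. [folklore] -/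
theorem sum_nhsNorm_mul_face_le (N : ℕ) (ψ : Site d → Matrix n n ℂ) (F : Site d → Fin d → ℝ) :
    ∑ z ∈ periodBox (d := d) N, ∑ κ : Fin d, nhsNorm (ψ z) * F z κ
      ≤ Real.sqrt ((d : ℝ) * ∑ z ∈ periodBox (d := d) N, nhsNormSq (ψ z))
        * Real.sqrt (∑ z ∈ periodBox (d := d) N, ∑ κ : Fin d, F z κ ^ 2) := by
  -- Cauchy–Schwarz with square roots over the product index set (the named lemma lives in an unrelated Literature module; inlined)
  have h : ∑ p ∈ periodBox (d := d) N ×ˢ (univ : Finset (Fin d)), nhsNorm (ψ p.1) * F p.1 p.2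
      ≤ Real.sqrt (∑ p ∈ periodBox (d := d) N ×ˢ (univ : Finset (Fin d)), nhsNorm (ψ p.1) ^ 2)
        * Real.sqrt (∑ p ∈ periodBox (d := d) N ×ˢ (univ : Finset (Fin d)), F p.1 p.2 ^ 2) := by
    rw [← Real.sqrt_mul (sum_nonneg fun _ _ => sq_nonneg _)]
    exact (le_abs_self _).trans (Real.abs_le_sqrt (sum_mul_sq_le_sq_mul_sq _ _ _))
  rw [sum_product, sum_product, sum_product] at h
  have hψ : ∑ z ∈ periodBox (d := d) N, ∑ _κ : Fin d, nhsNorm (ψ z) ^ 2 = (d : ℝ) * ∑ z ∈ periodBox (d := d) N, nhsNormSq (ψ z) := by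
    rw [mul_sum]
    refine sum_congr rfl fun z _ => ?_
    rw [sum_const, card_univ, Fintype.card_fin, nsmul_eq_mul, nhsNorm_sq]
  rw [hψ] at h
  exact h

omit [DecidableEq n] [Nonempty n] in
/-- The same with a weight depending on `(z, κ)`: `Σ_zΣ_κ nhsNorm (E z κ)·F z κ ≤ √(Σ_zΣ_κ nhsNormSq (E z κ))·√(Σ_zΣ_κ (F z κ)²)`. [folklore] -/
theorem sum_nhsNorm_mul_face_le' (N : ℕ) (E : Site d → Fin d → Matrix n n ℂ) (F : Site d → Fin d → ℝ) :
    ∑ z ∈ periodBox (d := d) N, ∑ κ : Fin d, nhsNorm (E z κ) * F z κ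
      ≤ Real.sqrt (∑ z ∈ periodBox (d := d) N, ∑ κ : Fin d, nhsNormSq (E z κ))
        * Real.sqrt (∑ z ∈ periodBox (d := d) N, ∑ κ : Fin d, F z κ ^ 2) := by
  have h : ∑ p ∈ periodBox (d := d) N ×ˢ (univ : Finset (Fin d)), nhsNorm (E p.1 p.2) * F p.1 p.2
      ≤ Real.sqrt (∑ p ∈ periodBox (d := d) N ×ˢ (univ : Finset (Fin d)), nhsNorm (E p.1 p.2) ^ 2)
        * Real.sqrt (∑ p ∈ periodBox (d := d) N ×ˢ (univ : Finset (Fin d)), F p.1 p.2 ^ 2) := by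
    rw [← Real.sqrt_mul (sum_nonneg fun _ _ => sq_nonneg _)]
    exact (le_abs_self _).trans (Real.abs_le_sqrt (sum_mul_sq_le_sq_mul_sq _ _ _))
  rw [sum_product, sum_product, sum_product] at h
  simp only [nhsNorm_sq] at h
  exact h

/-- The first-order letter of K4-c's face defects is nonnegative (`d, M ≥ 1`, `0 ≤ a`). [folklore] -/
theorem defectConst_nonneg (hd : 1 ≤ d) (hM : 1 ≤ M) (ha : 0 ≤ a) : 0 ≤ 2 * (((d : ℝ) - 1) * ((M : ℝ) - 1) * M * a) := by
  have hd' : (1 : ℝ) ≤ d := by exact_mod_cast hd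
  have hM' : (1 : ℝ) ≤ M := by exact_mod_cast hM
  have h1 : 0 ≤ ((d : ℝ) - 1) * ((M : ℝ) - 1) := mul_nonneg (by linarith) (by linarith)
  have h2 : 0 ≤ ((d : ℝ) - 1) * ((M : ℝ) - 1) * M := mul_nonneg h1 (by linarith)
  positivity

/-- **(P1) THE FAR-DEFECT PAIRING** (unitary `W`, `SmallField W a`, `0 ≤ a`, `d, M ≥ 1`; ANY coarse `ψ`, ANY `η`):
`|Σ_{z∈periodBox N} hsR (ψ z) (Σ_κ farDefect W M η z κ)| ≤ 2(d−1)(M−1)M·a·√(card n)·(√(d·Σ_z nhsNormSq (ψ z))·√(M^{d−1}·(2∕M·E_η + 2M·DG)))`. [folklore] -/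
theorem abs_sum_hsR_farDefect_le (hd : 1 ≤ d) (hM : 1 ≤ M) (N : ℕ) (hW : IsUnitaryCfg W) (ha : 0 ≤ a) (hWa : SmallField W a)
    (η : Site d → Fin d → Matrix n n ℂ) (ψ : Site d → Matrix n n ℂ) :
    |∑ z ∈ periodBox (d := d) N, hsR (ψ z) (∑ κ : Fin d, farDefect W M η z κ)|
      ≤ 2 * (((d : ℝ) - 1) * ((M : ℝ) - 1) * M * a) * Real.sqrt (Fintype.card n)
        * (Real.sqrt ((d : ℝ) * ∑ z ∈ periodBox (d := d) N, nhsNormSq (ψ z))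
          * Real.sqrt ((M : ℝ) ^ (d - 1) * (2 / (M : ℝ) * ∑ x ∈ periodBox (d := d) (M * N), ∑ κ : Fin d, nhsNormSq (η x κ)
              + 2 * (M : ℝ) * ∑ x ∈ periodBox (d := d) (M * N), ∑ κ : Fin d, nhsNormSq (covFd W η x κ κ)))) := by
  set c : ℝ := 2 * (((d : ℝ) - 1) * ((M : ℝ) - 1) * M * a) with hc
  have hc0 : 0 ≤ c := defectConst_nonneg hd hM ha
  have hcn : 0 ≤ c * Real.sqrt (Fintype.card n) := mul_nonneg hc0 (Real.sqrt_nonneg _)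
  set F : Site d → Fin d → ℝ := fun z κ =>
    ∑ r' : {j : Fin d // j ≠ κ} → Fin M, nhsNorm (η ((M : ℤ) • z + tbase κ r' + ((M : ℤ) - 1) • e κ) κ) with hF
  have hterm : ∀ (z : Site d) (κ : Fin d),
      |hsR (ψ z) (farDefect W M η z κ)| ≤ c * Real.sqrt (Fintype.card n) * (nhsNorm (ψ z) * F z κ) := by
    intro z κ
    calc |hsR (ψ z) (farDefect W M η z κ)| ≤ nhsNorm (ψ z) * ‖farDefect W M η z κ‖ := abs_hsR_le_nhsNorm_mul_opNorm _ _
      _ ≤ nhsNorm (ψ z) * (c * ∑ r' : {j : Fin d // j ≠ κ} → Fin M, ‖η ((M : ℤ) • z + tbase κ r' + ((M : ℤ) - 1) • e κ) κ‖) :=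
          mul_le_mul_of_nonneg_left (norm_farDefect_le hW ha hWa hM η z κ) (nhsNorm_nonneg _)
      _ ≤ nhsNorm (ψ z) * (c * (Real.sqrt (Fintype.card n) * F z κ)) :=
          mul_le_mul_of_nonneg_left (mul_le_mul_of_nonneg_left (sum_opNorm_le_sqrt_card_mul _ _) hc0) (nhsNorm_nonneg _)
      _ = c * Real.sqrt (Fintype.card n) * (nhsNorm (ψ z) * F z κ) := by ring
  have hFE := sum_sq_farFaceL1_le hM N hW η
  calc |∑ z ∈ periodBox (d := d) N, hsR (ψ z) (∑ κ : Fin d, farDefect W M η z κ)|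
      = |∑ z ∈ periodBox (d := d) N, ∑ κ : Fin d, hsR (ψ z) (farDefect W M η z κ)| := by
        simp only [hsR_sum_right]
    _ ≤ ∑ z ∈ periodBox (d := d) N, |∑ κ : Fin d, hsR (ψ z) (farDefect W M η z κ)| := abs_sum_le_sum_abs _ _
    _ ≤ ∑ z ∈ periodBox (d := d) N, ∑ κ : Fin d, |hsR (ψ z) (farDefect W M η z κ)| :=
        sum_le_sum fun z _ => abs_sum_le_sum_abs _ _
    _ ≤ ∑ z ∈ periodBox (d := d) N, ∑ κ : Fin d, c * Real.sqrt (Fintype.card n) * (nhsNorm (ψ z) * F z κ) :=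
        sum_le_sum fun z _ => sum_le_sum fun κ _ => hterm z κ
    _ = c * Real.sqrt (Fintype.card n) * ∑ z ∈ periodBox (d := d) N, ∑ κ : Fin d, nhsNorm (ψ z) * F z κ := by
        simp only [mul_sum]
    _ ≤ c * Real.sqrt (Fintype.card n) * (Real.sqrt ((d : ℝ) * ∑ z ∈ periodBox (d := d) N, nhsNormSq (ψ z))
          * Real.sqrt (∑ z ∈ periodBox (d := d) N, ∑ κ : Fin d, F z κ ^ 2)) :=
        mul_le_mul_of_nonneg_left (sum_nhsNorm_mul_face_le N ψ F) hcn
    _ ≤ _ := by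
        refine mul_le_mul_of_nonneg_left (mul_le_mul_of_nonneg_left (Real.sqrt_le_sqrt ?_) (Real.sqrt_nonneg _)) hcn
        simpa only [hF] using hFE

/-- **(P2) THE NEAR-DEFECT PAIRING** (unitary `(M·N)`-periodic setting: `η` `(M·N)`-periodic, `N ≥ 1`; `SmallField W a`, `0 ≤ a`, `d, M ≥ 1`;
ANY coarse `ψ`): `|Σ_{z∈periodBox N} hsR (ψ z) (Σ_κ nearDefect W M η z κ)| ≤ 2(d−1)(M−1)M·a·√(card n)·(√(d·Ψ)·√(M^{d−1}·(2∕M·E_η + 2M·DG)))`.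
[folklore] -/
theorem abs_sum_hsR_nearDefect_le (hd : 1 ≤ d) (hM : 1 ≤ M) (hN : 1 ≤ N) (hW : IsUnitaryCfg W) (ha : 0 ≤ a) (hWa : SmallField W a)
    (η : Site d → Fin d → Matrix n n ℂ) (hη : ∀ (x : Site d) (τ μ : Fin d), η (x + ((M * N : ℕ) : ℤ) • e τ) μ = η x μ)
    (ψ : Site d → Matrix n n ℂ) :
    |∑ z ∈ periodBox (d := d) N, hsR (ψ z) (∑ κ : Fin d, nearDefect W M η z κ)|
      ≤ 2 * (((d : ℝ) - 1) * ((M : ℝ) - 1) * M * a) * Real.sqrt (Fintype.card n)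
        * (Real.sqrt ((d : ℝ) * ∑ z ∈ periodBox (d := d) N, nhsNormSq (ψ z))
          * Real.sqrt ((M : ℝ) ^ (d - 1) * (2 / (M : ℝ) * ∑ x ∈ periodBox (d := d) (M * N), ∑ κ : Fin d, nhsNormSq (η x κ)
              + 2 * (M : ℝ) * ∑ x ∈ periodBox (d := d) (M * N), ∑ κ : Fin d, nhsNormSq (covFd W η x κ κ)))) := by
  set c : ℝ := 2 * (((d : ℝ) - 1) * ((M : ℝ) - 1) * M * a) with hc
  have hc0 : 0 ≤ c := defectConst_nonneg hd hM ha
  have hcn : 0 ≤ c * Real.sqrt (Fintype.card n) := mul_nonneg hc0 (Real.sqrt_nonneg _)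
  set F : Site d → Fin d → ℝ := fun z κ =>
    ∑ r' : {j : Fin d // j ≠ κ} → Fin M, nhsNorm (η ((M : ℤ) • z + tbase κ r' - e κ) κ) with hF
  have hterm : ∀ (z : Site d) (κ : Fin d),
      |hsR (ψ z) (nearDefect W M η z κ)| ≤ c * Real.sqrt (Fintype.card n) * (nhsNorm (ψ z) * F z κ) := by
    intro z κ
    calc |hsR (ψ z) (nearDefect W M η z κ)| ≤ nhsNorm (ψ z) * ‖nearDefect W M η z κ‖ := abs_hsR_le_nhsNorm_mul_opNorm _ _
      _ ≤ nhsNorm (ψ z) * (c * ∑ r' : {j : Fin d // j ≠ κ} → Fin M, ‖η ((M : ℤ) • z + tbase κ r' - e κ) κ‖) :=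
          mul_le_mul_of_nonneg_left (norm_nearDefect_le hW ha hWa hM η z κ) (nhsNorm_nonneg _)
      _ ≤ nhsNorm (ψ z) * (c * (Real.sqrt (Fintype.card n) * F z κ)) :=
          mul_le_mul_of_nonneg_left (mul_le_mul_of_nonneg_left (sum_opNorm_le_sqrt_card_mul _ _) hc0) (nhsNorm_nonneg _)
      _ = c * Real.sqrt (Fintype.card n) * (nhsNorm (ψ z) * F z κ) := by ring
  have hFE := sum_sq_nearFaceL1_le hM hN hW η hη
  calc |∑ z ∈ periodBox (d := d) N, hsR (ψ z) (∑ κ : Fin d, nearDefect W M η z κ)|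
      = |∑ z ∈ periodBox (d := d) N, ∑ κ : Fin d, hsR (ψ z) (nearDefect W M η z κ)| := by
        simp only [hsR_sum_right]
    _ ≤ ∑ z ∈ periodBox (d := d) N, |∑ κ : Fin d, hsR (ψ z) (nearDefect W M η z κ)| := abs_sum_le_sum_abs _ _
    _ ≤ ∑ z ∈ periodBox (d := d) N, ∑ κ : Fin d, |hsR (ψ z) (nearDefect W M η z κ)| :=
        sum_le_sum fun z _ => abs_sum_le_sum_abs _ _
    _ ≤ ∑ z ∈ periodBox (d := d) N, ∑ κ : Fin d, c * Real.sqrt (Fintype.card n) * (nhsNorm (ψ z) * F z κ) :=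
        sum_le_sum fun z _ => sum_le_sum fun κ _ => hterm z κ
    _ = c * Real.sqrt (Fintype.card n) * ∑ z ∈ periodBox (d := d) N, ∑ κ : Fin d, nhsNorm (ψ z) * F z κ := by
        simp only [mul_sum]
    _ ≤ c * Real.sqrt (Fintype.card n) * (Real.sqrt ((d : ℝ) * ∑ z ∈ periodBox (d := d) N, nhsNormSq (ψ z))
          * Real.sqrt (∑ z ∈ periodBox (d := d) N, ∑ κ : Fin d, F z κ ^ 2)) :=
        mul_le_mul_of_nonneg_left (sum_nhsNorm_mul_face_le N ψ F) hcn
    _ ≤ _ := by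
        refine mul_le_mul_of_nonneg_left (mul_le_mul_of_nonneg_left (Real.sqrt_le_sqrt ?_) (Real.sqrt_nonneg _)) hcn
        simpa only [hF] using hFE

/-- **(P3) THE COARSE-MISMATCH PAIRING** (unitary `W`, `U`; `η` `(M·N)`-periodic, `N ≥ 1`, `d, M ≥ 1`; a displayed bond-closeness letter
`‖U z κ − bseg M W z κ‖ ≤ β`, instantiated in K6 by NE3-R2 g8's J4 `NE3TowerBondVsSegment.norm_cavgIter_sub_bseg_le`; NO smallness of `W`):
`|Σ_{z∈periodBox N} hsR (ψ z) (coarseMismatch U W M η z)| ≤ 2β·√(card n)·(√(d·Ψ)·√(M^{d−1}·(2∕M·E_η + 2M·DG)))`. [folklore] -/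
theorem abs_sum_hsR_coarseMismatch_le (hd : 1 ≤ d) (hM : 1 ≤ M) (hN : 1 ≤ N) (hW : IsUnitaryCfg W)
    {U : Site d → Fin d → (Matrix n n ℂ)ˣ} (hU : IsUnitaryCfg U) {β : ℝ}
    (hUb : ∀ (z : Site d) (κ : Fin d), ‖((U z κ : (Matrix n n ℂ)ˣ) : Matrix n n ℂ) - ((bseg M W z κ : (Matrix n n ℂ)ˣ) : Matrix n n ℂ)‖ ≤ β)
    (η : Site d → Fin d → Matrix n n ℂ) (hη : ∀ (x : Site d) (τ μ : Fin d), η (x + ((M * N : ℕ) : ℤ) • e τ) μ = η x μ)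
    (ψ : Site d → Matrix n n ℂ) :
    |∑ z ∈ periodBox (d := d) N, hsR (ψ z) (coarseMismatch U W M η z)|
      ≤ 2 * β * Real.sqrt (Fintype.card n)
        * (Real.sqrt ((d : ℝ) * ∑ z ∈ periodBox (d := d) N, nhsNormSq (ψ z))
          * Real.sqrt ((M : ℝ) ^ (d - 1) * (2 / (M : ℝ) * ∑ x ∈ periodBox (d := d) (M * N), ∑ κ : Fin d, nhsNormSq (η x κ)
              + 2 * (M : ℝ) * ∑ x ∈ periodBox (d := d) (M * N), ∑ κ : Fin d, nhsNormSq (covFd W η x κ κ)))) := by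
  have hβ : 0 ≤ β := (norm_nonneg _).trans (hUb 0 ⟨0, hd⟩)
  have hcn : 0 ≤ 2 * β * Real.sqrt (Fintype.card n) := by positivity
  set F : Site d → Fin d → ℝ := fun z κ =>
    ∑ r' : {j : Fin d // j ≠ κ} → Fin M, nhsNorm (η ((M : ℤ) • (z + -e κ) + tbase κ r' + ((M : ℤ) - 1) • e κ) κ) with hF
  have hterm : ∀ z : Site d,
      |hsR (ψ z) (coarseMismatch U W M η z)| ≤ 2 * β * Real.sqrt (Fintype.card n) * ∑ κ : Fin d, nhsNorm (ψ z) * F z κ := by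
    intro z
    have h1 := norm_coarseMismatch_le hU hW M η z
    have h2 : ∀ κ : Fin d, 2 * ‖((U (z - e κ) κ : (Matrix n n ℂ)ˣ) : Matrix n n ℂ) - ((bseg M W (z - e κ) κ : (Matrix n n ℂ)ˣ) : Matrix n n ℂ)‖
          * ∑ r' : {j : Fin d // j ≠ κ} → Fin M, ‖η ((M : ℤ) • (z - e κ) + tbase κ r' + ((M : ℤ) - 1) • e κ) κ‖
        ≤ 2 * β * (Real.sqrt (Fintype.card n) * F z κ) := by
      intro κ
      have hsub : z - e κ = z + -e κ := sub_eq_add_neg z (e κ)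
      refine mul_le_mul (mul_le_mul_of_nonneg_left (hUb _ κ) (by norm_num)) ?_ (sum_nonneg fun _ _ => norm_nonneg _) (by positivity)
      rw [hF, hsub]
      exact sum_opNorm_le_sqrt_card_mul _ _
    calc |hsR (ψ z) (coarseMismatch U W M η z)| ≤ nhsNorm (ψ z) * ‖coarseMismatch U W M η z‖ := abs_hsR_le_nhsNorm_mul_opNorm _ _
      _ ≤ nhsNorm (ψ z) * ∑ κ : Fin d, 2 * β * (Real.sqrt (Fintype.card n) * F z κ) :=
          mul_le_mul_of_nonneg_left (h1.trans (sum_le_sum fun κ _ => h2 κ)) (nhsNorm_nonneg _)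
      _ = 2 * β * Real.sqrt (Fintype.card n) * ∑ κ : Fin d, nhsNorm (ψ z) * F z κ := by
          rw [mul_sum, mul_sum]
          exact sum_congr rfl fun κ _ => by ring
  have hFE := sum_sq_farFaceL1_shift_le hM hN hW η hη
  calc |∑ z ∈ periodBox (d := d) N, hsR (ψ z) (coarseMismatch U W M η z)|
      ≤ ∑ z ∈ periodBox (d := d) N, |hsR (ψ z) (coarseMismatch U W M η z)| := abs_sum_le_sum_abs _ _
    _ ≤ ∑ z ∈ periodBox (d := d) N, 2 * β * Real.sqrt (Fintype.card n) * ∑ κ : Fin d, nhsNorm (ψ z) * F z κ :=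
        sum_le_sum fun z _ => hterm z
    _ = 2 * β * Real.sqrt (Fintype.card n) * ∑ z ∈ periodBox (d := d) N, ∑ κ : Fin d, nhsNorm (ψ z) * F z κ := by
        rw [mul_sum]
    _ ≤ 2 * β * Real.sqrt (Fintype.card n) * (Real.sqrt ((d : ℝ) * ∑ z ∈ periodBox (d := d) N, nhsNormSq (ψ z))
          * Real.sqrt (∑ z ∈ periodBox (d := d) N, ∑ κ : Fin d, F z κ ^ 2)) :=
        mul_le_mul_of_nonneg_left (sum_nhsNorm_mul_face_le N ψ F) hcn
    _ ≤ _ := by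
        refine mul_le_mul_of_nonneg_left (mul_le_mul_of_nonneg_left (Real.sqrt_le_sqrt ?_) (Real.sqrt_nonneg _)) hcn
        simpa only [hF] using hFE

/-- **(P4) THE FACE-JUMP PAIRING OF THE NON-EXACT PART, IN ℓ²** (unitary `W`, `M ≥ 1`; ANY coarse `E`, ANY `η`): K4-d2's
`abs_sum_hsR_JmpW_le` with the face `ℓ¹` sums traded by the trace inequality —
`|Σ_{x∈periodBox (M·N)}Σ_κ hsR (JmpW M W E x κ) (η x κ)| ≤ M²·√(Σ_{z∈periodBox N}Σ_κ nhsNormSq (E z κ))·√(M^{d−1}·(2∕M·E_η + 2M·DG))`. [folklore] -/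
theorem abs_sum_hsR_JmpW_le_sqrt (hM : 1 ≤ M) (N : ℕ) (hW : IsUnitaryCfg W) (E η : Site d → Fin d → Matrix n n ℂ) :
    |∑ x ∈ periodBox (d := d) (M * N), ∑ κ : Fin d, hsR (JmpW M W E x κ) (η x κ)|
      ≤ (M : ℝ) ^ 2 * (Real.sqrt (∑ z ∈ periodBox (d := d) N, ∑ κ : Fin d, nhsNormSq (E z κ))
          * Real.sqrt ((M : ℝ) ^ (d - 1) * (2 / (M : ℝ) * ∑ x ∈ periodBox (d := d) (M * N), ∑ κ : Fin d, nhsNormSq (η x κ)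
              + 2 * (M : ℝ) * ∑ x ∈ periodBox (d := d) (M * N), ∑ κ : Fin d, nhsNormSq (covFd W η x κ κ)))) := by
  set F : Site d → Fin d → ℝ := fun z κ =>
    ∑ r' : {j : Fin d // j ≠ κ} → Fin M, nhsNorm (η ((M : ℤ) • z + tbase κ r' + ((M : ℤ) - 1) • e κ) κ) with hF
  have h1 := abs_sum_hsR_JmpW_le hM N hW E η
  have hFE := sum_sq_farFaceL1_le hM N hW η
  have hM2 : (0 : ℝ) ≤ (M : ℝ) ^ 2 := by positivity
  calc |∑ x ∈ periodBox (d := d) (M * N), ∑ κ : Fin d, hsR (JmpW M W E x κ) (η x κ)|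
      ≤ (M : ℝ) ^ 2 * ∑ z ∈ periodBox (d := d) N, ∑ κ : Fin d, nhsNorm (E z κ) * F z κ := by simpa only [hF] using h1
    _ ≤ (M : ℝ) ^ 2 * (Real.sqrt (∑ z ∈ periodBox (d := d) N, ∑ κ : Fin d, nhsNormSq (E z κ))
          * Real.sqrt (∑ z ∈ periodBox (d := d) N, ∑ κ : Fin d, F z κ ^ 2)) :=
        mul_le_mul_of_nonneg_left (sum_nhsNorm_mul_face_le' N E F) hM2
    _ ≤ _ := by
        refine mul_le_mul_of_nonneg_left (mul_le_mul_of_nonneg_left (Real.sqrt_le_sqrt ?_) (Real.sqrt_nonneg _)) hM2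
        simpa only [hF] using hFE

end Pairings

end

end Summit.QuantumFields.BalabanUV.T4Continuum.NE3CovariantFacePairings
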